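import Summits.BirchSwinnertonDyer.BirchSwinnertonDyer.Theorems.SignedLowerHalvesSmallImageLowerHalfBothSignsRttCharRoadCurveJcurveClosed
import Summits.BirchSwinnertonDyer.BirchSwinnertonDyer.Theorems.SignedLowerHalvesSmallImageLowerHalfBothSignsRttCharRoadJGlue
import HarnessLib

/-!
# Route `SignedLowerHalves`, crux L `SmallImageLowerHalfBothSigns` (stmt-BirchSwinnertonDyer-23599), line `rtt_w3` — row J: the data
# conjunct `hJD` of `stub_charRoad_ns` (v8) is a THEOREM: `charRoadJD_holds := charRoadJD_of_curveSide charRoad_Jcurve`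

Hand `bsd-inputs-honda-p1` g18 (α-lane).  Composition of two accepted pieces: `charRoad_Jcurve : hJcurve` (`…RttCharRoadCurveJcurveClosed.lean`,
`bsd-line-slh-p3-w3` g17, p764501 — itself `curveSide_of_alphaLocModel` applied to this hand's Stage C3 `exists_alphaLoc`, p764145) and the J-glue
`charRoadJD_of_curveSide` of the LEAD `cruxlead-stmt-BirchSwinnertonDyer-23599` g5 (`…RttCharRoadJGlue.lean`, p761968).  Helper
`--supports stmt-BirchSwinnertonDyer-23599`; ONE THEOREM, no `sorry`, no hypothesis.  CLOSES NOTHING by itself (the registered stub also carries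
E1/COUNT ∧ E2, research residue); BSD / crux L are NOT proved.

References: [Kobayashi2003] §8 (proof of Thm. 8.4); [deShalit1987] II.1; [LubinTate1965] §2 Thm. 2 and Cor.
-/

set_option autoImplicit false
-- D-0017: single-problem summit, the namespace repeats the problem name by design.
set_option linter.dupNamespace false
noncomputable section

open scoped Classical MatrixGroups ModularForm BigOperators NumberField
open CongruenceSubgroup WeierstrassCurve Field Polynomial NumberField IsDedekindDomain Matrix ValuativeRel
  Literature.NumberTheory.EllipticCurves Literature.NumberTheory.EllipticCurves.ModularForms
  Literature.NumberTheory.EllipticCurves.Rank1Residual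
  Literature.NumberTheory.EllipticCurves.Kobayashi2003
  Literature.NumberTheory.EllipticCurves.GreenbergVatsal2000 ZpExtension
  Literature.NumberTheory.IwasawaTheory Rat.HeightOneSpectrum
  Literature.NumberTheory.GaloisRepresentations Literature.NumberTheory.LFunctions
  Literature.NumberTheory.GaloisRepresentations.HeckeCharacter Literature.NumberTheory.Automorphic
  Literature.NumberTheory.GaloisRepresentations.IsNonarchimedeanLocalField Literature.NumberTheory.GaloisRepresentations.LubinTate
  Literature.NumberTheory.NumberFields
  Summit.BirchSwinnertonDyer.Rank1Residual Summit.BirchSwinnertonDyer.Rank1Residual.Supersingular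
  Summit.BirchSwinnertonDyer.Rank1Residual.X1.MuLambda
  Summit.BirchSwinnertonDyer.Rank1Residual.X2.EulerFactorInvariants
  Summit.BirchSwinnertonDyer.BirchSwinnertonDyer.Theorems.SmallImageLambdaLowerThreeNsThetaTransport
  Summit.BirchSwinnertonDyer.BirchSwinnertonDyer.Theorems.HeckeThetaPartner
  Summit.BirchSwinnertonDyer.BirchSwinnertonDyer.Theorems

namespace Summit.BirchSwinnertonDyer.BirchSwinnertonDyer.Theorems.SmallImageRttCharRoad

/-- ★★★ **`hJD` — the data conjunct of `stub_charRoad_ns` (v8), UNCONDITIONAL**: the J-glue `charRoadJD_of_curveSide` (LEAD g5, p761968)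
fed with `charRoad_Jcurve` (`…RttCharRoadCurveJcurveClosed`, w3 g17 p764501 = `curveSide_of_alphaLocModel` ∘ this hand's `exists_alphaLoc`).  [cite: Kobayashi2003, §8 (proof of Thm. 8.4)] [cite: deShalit1987, II.1] -/
theorem charRoadJD_holds :
    ∀ (W : WeierstrassCurve ℚ) [W.IsElliptic] [W.IsGloballyMinimal] (p : ℕ) [Fact p.Prime],
          p ≠ 2 → ClassX7 W p → ¬ W.HasCM → W.frobeniusTrace p = 0 → ¬ Surj W p →
          ¬ (∃ (A : WeierstrassCurve ℚ) (_ : A.IsElliptic) (_ : A.IsGloballyMinimal),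
            A.HasCM ∧ GoodSS A p ∧ A.frobeniusTrace p = 0 ∧
              ∃ e : geomTorsion W (p : ℤ) ≃+ geomTorsion A (p : ℤ),
                ∀ (σ : absoluteGaloisGroup ℚ) (P : geomTorsion W (p : ℤ)), e (σ • P) = σ • e P) →
          ¬ (∃ (A : WeierstrassCurve ℚ) (_ : A.IsElliptic) (_ : A.IsGloballyMinimal) (t : ℚ),
            A.HasGoodReductionAtPrime p ∧ A.frobeniusTrace p = 0 ∧
              (∃ e : geomTorsion W (p : ℤ) ≃+ geomTorsion A (p : ℤ),
                ∀ (σ : absoluteGaloisGroup ℚ) (P : geomTorsion W (p : ℤ)), e (σ • P) = σ • e P) ∧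
              A.entireLFunction 1 / (A.realPeriodRat : ℂ) = ((t : ℚ) : ℂ) ∧ t ≠ 0 ∧ padicValRat p t = 0) →
          ∀ (ε : ℤˣ) (K : Type) [Field K] [NumberField K] (σK : K →+* ℂ) (𝔪 : Ideal (𝓞 K))
            (ψ : HeightOneSpectrum (𝓞 K) → ℂ) (e : PadicAlgCl p ≃+* ℂ),
            Module.finrank ℚ K = 2 → IsTotallyComplex K → 𝔪 ≠ ⊥ →
            (∀ I : Ideal (𝓞 K), Ideal.absNorm I ≠ p) → ¬ p ∣ (NumberField.discr K).natAbs * Ideal.absNorm 𝔪 →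
            (∀ (ℓ : ℕ) [Fact ℓ.Prime], ℓ ∣ (NumberField.discr K).natAbs * Ideal.absNorm 𝔪 → ¬ W.HasGoodReductionAtPrime ℓ) →
            IsGrossencharakter 𝔪 (embType σK) (embTypeConj σK) ψ →
            (∀ n : ℕ, Odd n → n.Coprime ((NumberField.discr K).natAbs * Ideal.absNorm 𝔪) →
              idealPow K ψ (Ideal.span {(n : 𝓞 K)}) = (jacobiSym (NumberField.discr K) n : ℂ) * (n : ℂ) ^ (2 - 1)) →
            (∀ (ℓ : ℕ) [Fact ℓ.Prime], ℓ ≠ p → W.HasGoodReductionAtPrime ℓ →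
              ‖e.symm (∑ᶠ (w : HeightOneSpectrum (𝓞 K)) (_ : Ideal.absNorm w.asIdeal = ℓ), ψ w) -
                (W.frobeniusTrace ℓ : PadicAlgCl p)‖ < 1) →
            (∃ v : HeightOneSpectrum (𝓞 K), v.asIdeal = Ideal.span {(p : 𝓞 K)} ∧ Nat.card (𝓞 K ⧸ v.asIdeal) = p ^ 2) →
            ¬ (p : ℤ) ∣ NumberField.discr K →
            ∃ (S : Set (PadicAlgCl p)) (θ : FramedGaloisRep K (padicCoeffIntegers S) 1)
              (j : (W.baseChange K).geomPrimaryTorsion p →+ (GreenbergSelmer.Cofree θ (padicCoeffField S))),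
              0 < Module.finrank ℚ_[p] (padicCoeffField S) ∧
              (∀ w : HeightOneSpectrum (𝓞 K), (p : 𝓞 K) ∉ w.asIdeal → ¬ 𝔪 ≤ w.asIdeal →
                θ.IsUnramifiedAt w ∧ ∃ P : Polynomial (padicCoeffIntegers S),
                  P.map (padicCoeffIntegers S).subtype = X - C (e.symm (ψ w)) ∧ θ.HasFrobCharpolyAt w P) ∧
              (∀ v : HeightOneSpectrum (𝓞 K), (p : 𝓞 K) ∈ v.asIdeal →
                ∀ (δ : absoluteGaloisGroup (v.adicCompletion K)) (t : (W.baseChange K).geomPrimaryTorsion p),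
                  j (resGalOfEmb (closureEmb (K := K) (v.adicCompletion K)) δ • t) =
                    resGalOfEmb (closureEmb (K := K) (v.adicCompletion K)) δ • j t) ∧
              Submodule.span (padicCoeffIntegers S) (Set.range j) = ⊤ :=
  charRoadJD_of_curveSide charRoad_Jcurve

end Summit.BirchSwinnertonDyer.BirchSwinnertonDyer.Theorems.SmallImageRttCharRoad

end
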